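import Summits.CriticalPhenomena.PercolationContinuityZ3.Theorems.PercNearOneGluingNoHeavyLowerTailCertCheckSound
import HarnessLib

/-!
# `NoHeavyLowerTail` (stmt-CriticalPhenomena-4575) — certificate machine add-on: GENERAL polynomial certificates
# (explicit plus/minus term lists, product rows, LINEAR hypothesis rows) and QUADRATIC-FORM targets

Support file (prover prim-ineq-prove-1, new-inequality factory, prove seat; `--supports stmt-CriticalPhenomena-4575`).
Computable definitions + soundness; no named facts, no sorries, standard axioms.

The reflective checker of `…CertCheck` (`check L U rows al`, soundness `CertCheck.sound`) proves targets of the shape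
`Σ_a w_a m_a (L − U_{ref a}) ≤ 0` — one target event `L` against reference events — from valid PRODUCT rows
`E₁E₂ ≤ E₃E₄`.  The LP lanes of the factory (ttrl `wf3lp`, the inequality harness) certify more general identities
      `M₀ · F  =  Σ_r λ_r m_r · (E₃E₄ − E₁E₂)_r  +  Σ_h κ_h m'_h · h  +  slack`,
with `F` a QUADRATIC form in the cell masses (e.g. the factory target `TGT-COND3`: `μ(o↔A)·μ(a₁↮b) − μ({o↔A}∩{o↮b})·1 ≥ 0`,
Kozma–Nitzan's Conjecture 1 at `|A| = 3`), LINEAR hypotheses `h = μ(E_hi) − μ(E_lo) ≥ 0` (the worst-relay ordering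
`μ(a₁↮b) ≥ μ(a_j↮b)`), and a multiplier `M₀` that is a nonnegative combination of monomials.  This file extends the checker to
that shape WITHOUT touching its algebra (`normalize`, `dominated`, `pairTerms`, `linTerms` of `…CertCheck` are reused):

* `LinRow` — a linear row `μ(eLo) ≤ μ(eHi)` used with monomial multiplier and weight (hypothesis rows);
* `plusTermsG` / `minusTermsG` / `checkG` / `checkGB` — the check with EXPLICIT extra plus/minus term lists, product rows and
  linear rows; `soundG`, `soundG_of_buckets`: rows valid IN SUM at `x ≥ 0` (so SHK groups of `…CertRowsSHK` are admissible;
  `rowSumLE_of_forall` for row-by-row validity) and the check passes ⇒ `evalT plus ≤ evalT minus`;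
* `QTerm`, `qval`, `m0val`, `qTerms`, `checkQ` / `checkQB` — a signed quadratic form `F = Σ ± c·μ(e₁)μ(e₂)` and a multiplier
  `M₀ = Σ w·m`, expanded into term lists; `soundQ` / `soundQ_of_buckets`: `0 ≤ m0val · qval`; `qval_nonneg_of_pos`: `M₀(x) > 0 ⇒ F(x) ≥ 0`;
* `m0val_pos` — positivity of `M₀` from positivity of the cells it uses.
Part 2 (application file) instantiates `x` with the pattern-cell law of five terminals (`…CertCells`) and removes the
positivity proviso by weight continuity as in `…CertPositivity`.
-/

namespace Summit.CriticalPhenomena.PercolationContinuityZ3.Theorems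

namespace CertCheck

/-! ## Linear rows and the general check -/

/-- A linear row `μ(eLo) ≤ μ(eHi)` (events as cell lists) used with monomial multiplier `mult` and weight `wt`
(hypothesis rows such as `μ(a_j ↮ b) ≤ μ(a₁ ↮ b)`). [folklore] -/
structure LinRow where
  /-- cells of the smaller side -/
  eLo : List ℕ
  /-- cells of the larger side -/
  eHi : List ℕ
  /-- monomial multiplier -/
  mult : List ℕ
  /-- nonnegative integer weight -/
  wt : ℕ
  deriving DecidableEq, Repr

/-- General plus side: explicit terms + `Σ_r w_r m_r E₃E₄` + `Σ_h w_h m_h E_hi`. [folklore] -/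
def plusTermsG (plus : List Term) (rows : List Row) (lrows : List LinRow) : List Term :=
  plus ++ (rows.flatMap fun r => pairTerms r.e3 r.e4 r.mult r.wt) ++ lrows.flatMap fun r => linTerms r.eHi r.mult r.wt

/-- General minus side: explicit terms + `Σ_r w_r m_r E₁E₂` + `Σ_h w_h m_h E_lo`. [folklore] -/
def minusTermsG (minus : List Term) (rows : List Row) (lrows : List LinRow) : List Term :=
  minus ++ (rows.flatMap fun r => pairTerms r.e1 r.e2 r.mult r.wt) ++ lrows.flatMap fun r => linTerms r.eLo r.mult r.wt

/-- THE GENERAL CHECK: coefficientwise domination of the general plus side by the general minus side. [folklore] -/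
def checkG (plus minus : List Term) (rows : List Row) (lrows : List LinRow) : Bool :=
  dominated (normalize (plusTermsG plus rows lrows)) (normalize (minusTermsG minus rows lrows))

/-- The bucketed general check (bucket `b` of `nb`). [folklore] -/
def checkGB (nb b : ℕ) (plus minus : List Term) (rows : List Row) (lrows : List LinRow) : Bool :=
  dominated (normalize ((plusTermsG plus rows lrows).filter fun t => bucket nb t == b))
    (normalize ((minusTermsG minus rows lrows).filter fun t => bucket nb t == b))

variable (x : ℕ → ℝ)

/-- Value of the general plus side. [folklore] -/
theorem evalT_plusTermsG (plus : List Term) (rows : List Row) (lrows : List LinRow) :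
    evalT x (plusTermsG plus rows lrows) = evalT x plus +
      (rows.map fun r => (r.wt : ℝ) * evalM x r.mult * (linEval x r.e3 * linEval x r.e4)).sum +
        (lrows.map fun r => (r.wt : ℝ) * evalM x r.mult * linEval x r.eHi).sum := by
  unfold plusTermsG
  rw [evalT_append, evalT_append, evalT_flatMap, evalT_flatMap]
  simp only [evalT_linTerms, evalT_pairTerms]

/-- Value of the general minus side. [folklore] -/
theorem evalT_minusTermsG (minus : List Term) (rows : List Row) (lrows : List LinRow) :
    evalT x (minusTermsG minus rows lrows) = evalT x minus +
      (rows.map fun r => (r.wt : ℝ) * evalM x r.mult * (linEval x r.e1 * linEval x r.e2)).sum +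
        (lrows.map fun r => (r.wt : ℝ) * evalM x r.mult * linEval x r.eLo).sum := by
  unfold minusTermsG
  rw [evalT_append, evalT_append, evalT_flatMap, evalT_flatMap]
  simp only [evalT_linTerms, evalT_pairTerms]

/-- Row-by-row validity gives the SUMMED form `Σ_r w_r m_r E₁E₂ ≤ Σ_r w_r m_r E₃E₄` used below (the summed form also admits
sunflower / strong-Harris–Kleitman GROUPS of rows, `…CertRowsSHK`). [folklore] -/
theorem rowSumLE_of_forall (hx : ∀ i, 0 ≤ x i) (rows : List Row)
    (hrows : ∀ r ∈ rows, linEval x r.e1 * linEval x r.e2 ≤ linEval x r.e3 * linEval x r.e4) :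
    (rows.map fun r => (r.wt : ℝ) * evalM x r.mult * (linEval x r.e1 * linEval x r.e2)).sum ≤
      (rows.map fun r => (r.wt : ℝ) * evalM x r.mult * (linEval x r.e3 * linEval x r.e4)).sum := by
  apply List.sum_le_sum
  intro r hr
  exact mul_le_mul_of_nonneg_left (hrows r hr) (mul_nonneg (Nat.cast_nonneg _) (evalM_nonneg x hx _))

/-- From domination of the general sides to `evalT plus ≤ evalT minus`. [folklore] -/
theorem le_of_evalT_G_le (hx : ∀ i, 0 ≤ x i) (plus minus : List Term) (rows : List Row) (lrows : List LinRow)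
    (hrows : (rows.map fun r => (r.wt : ℝ) * evalM x r.mult * (linEval x r.e1 * linEval x r.e2)).sum ≤
      (rows.map fun r => (r.wt : ℝ) * evalM x r.mult * (linEval x r.e3 * linEval x r.e4)).sum)
    (hlrows : ∀ r ∈ lrows, linEval x r.eLo ≤ linEval x r.eHi)
    (hdom : evalT x (plusTermsG plus rows lrows) ≤ evalT x (minusTermsG minus rows lrows)) :
    evalT x plus ≤ evalT x minus := by
  rw [evalT_plusTermsG, evalT_minusTermsG] at hdom
  have hR : (rows.map fun r => (r.wt : ℝ) * evalM x r.mult * (linEval x r.e1 * linEval x r.e2)).sum ≤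
      (rows.map fun r => (r.wt : ℝ) * evalM x r.mult * (linEval x r.e3 * linEval x r.e4)).sum := hrows
  have hL : (lrows.map fun r => (r.wt : ℝ) * evalM x r.mult * linEval x r.eLo).sum ≤
      (lrows.map fun r => (r.wt : ℝ) * evalM x r.mult * linEval x r.eHi).sum := by
    apply List.sum_le_sum
    intro r hr
    exact mul_le_mul_of_nonneg_left (hlrows r hr) (mul_nonneg (Nat.cast_nonneg _) (evalM_nonneg x hx _))
  linarith

/-- **Soundness of the general check.** [folklore] -/
theorem soundG (hx : ∀ i, 0 ≤ x i) (plus minus : List Term) (rows : List Row) (lrows : List LinRow)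
    (hrows : (rows.map fun r => (r.wt : ℝ) * evalM x r.mult * (linEval x r.e1 * linEval x r.e2)).sum ≤
      (rows.map fun r => (r.wt : ℝ) * evalM x r.mult * (linEval x r.e3 * linEval x r.e4)).sum)
    (hlrows : ∀ r ∈ lrows, linEval x r.eLo ≤ linEval x r.eHi)
    (h : checkG plus minus rows lrows = true) : evalT x plus ≤ evalT x minus := by
  have hdom := evalT_le_of_dominated x hx _ _ h
  rw [evalT_normalize, evalT_normalize] at hdom
  exact le_of_evalT_G_le x hx plus minus rows lrows hrows hlrows hdom

/-- **Soundness of the bucketed general check.** [folklore] -/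
theorem soundG_of_buckets (hx : ∀ i, 0 ≤ x i) (plus minus : List Term) (rows : List Row) (lrows : List LinRow)
    {nb : ℕ} (hnb : 0 < nb)
    (hrows : (rows.map fun r => (r.wt : ℝ) * evalM x r.mult * (linEval x r.e1 * linEval x r.e2)).sum ≤
      (rows.map fun r => (r.wt : ℝ) * evalM x r.mult * (linEval x r.e3 * linEval x r.e4)).sum)
    (hlrows : ∀ r ∈ lrows, linEval x r.eLo ≤ linEval x r.eHi)
    (h : ∀ b < nb, checkGB nb b plus minus rows lrows = true) : evalT x plus ≤ evalT x minus := by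
  have hdom : evalT x (plusTermsG plus rows lrows) ≤ evalT x (minusTermsG minus rows lrows) := by
    rw [evalT_eq_sum_buckets x hnb (plusTermsG plus rows lrows),
      evalT_eq_sum_buckets x hnb (minusTermsG minus rows lrows)]
    apply List.sum_le_sum
    intro b hb
    have hc := h b (List.mem_range.1 hb)
    have := evalT_le_of_dominated x hx _ _ hc
    rwa [evalT_normalize, evalT_normalize] at this
  exact le_of_evalT_G_le x hx plus minus rows lrows hrows hlrows hdom

/-! ## Quadratic-form targets with a polynomial multiplier -/

/-- A signed quadratic term `± coef · μ(e₁) · μ(e₂)` (events as cell lists). [folklore] -/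
structure QTerm where
  /-- cells of the first factor -/
  e1 : List ℕ
  /-- cells of the second factor -/
  e2 : List ℕ
  /-- natural coefficient -/
  coef : ℕ
  /-- sign: `true` = `+`, `false` = `−` -/
  pos : Bool
  deriving DecidableEq, Repr

/-- Unsigned value of a quadratic term. [folklore] -/
noncomputable def QTerm.val (t : QTerm) : ℝ := (t.coef : ℝ) * (linEval x t.e1 * linEval x t.e2)

/-- Value of a signed quadratic form. [folklore] -/
noncomputable def qval (ts : List QTerm) : ℝ := (ts.map fun t => if t.pos then t.val x else -t.val x).sum

/-- Value of a multiplier `M₀ = Σ w · m` (list of (monomial, weight)). [folklore] -/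
noncomputable def m0val (M0 : List (List ℕ × ℕ)) : ℝ := (M0.map fun p => (p.2 : ℝ) * evalM x p.1).sum

/-- The terms of `M₀ · (part of F with sign b)`. [folklore] -/
def qTerms (M0 : List (List ℕ × ℕ)) (ts : List QTerm) (b : Bool) : List Term :=
  M0.flatMap fun p => (ts.filter fun t => t.pos == b).flatMap fun t => pairTerms t.e1 t.e2 p.1 (p.2 * t.coef)

/-- THE QUADRATIC CHECK: `M₀ · F⁻ + rows⁺ + …` dominated by `M₀ · F⁺ + rows⁻ + …`. [folklore] -/
def checkQ (M0 : List (List ℕ × ℕ)) (ts : List QTerm) (rows : List Row) (lrows : List LinRow) : Bool :=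
  checkG (qTerms M0 ts false) (qTerms M0 ts true) rows lrows

/-- The bucketed quadratic check. [folklore] -/
def checkQB (nb b : ℕ) (M0 : List (List ℕ × ℕ)) (ts : List QTerm) (rows : List Row) (lrows : List LinRow) : Bool :=
  checkGB nb b (qTerms M0 ts false) (qTerms M0 ts true) rows lrows

/-- Value of the signed part `b` of a quadratic form. [folklore] -/
theorem sum_filter_val (ts : List QTerm) (b : Bool) :
    ((ts.filter fun t => t.pos == b).map fun t => t.val x).sum =
      (ts.map fun t => if t.pos = b then t.val x else 0).sum := by
  induction ts with
  | nil => simp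
  | cons t ts ih =>
    rw [List.filter_cons]
    by_cases h : t.pos = b
    · simp [h, ih]
    · simp [h, ih]

/-- Value of the expanded terms `M₀ · F^b`. [folklore] -/
theorem evalT_qTerms (M0 : List (List ℕ × ℕ)) (ts : List QTerm) (b : Bool) :
    evalT x (qTerms M0 ts b) = m0val x M0 * ((ts.filter fun t => t.pos == b).map fun t => t.val x).sum := by
  unfold qTerms m0val
  rw [evalT_flatMap]
  induction M0 with
  | nil => simp
  | cons p M0 ih =>
    rw [List.map_cons, List.sum_cons, ih, List.map_cons, List.sum_cons, add_mul]
    congr 1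
    rw [evalT_flatMap]
    simp only [evalT_pairTerms, QTerm.val, Nat.cast_mul]
    rw [← List.sum_map_mul_left]
    congr 1
    refine List.map_congr_left fun t _ => ?_
    ring

/-- `qval` is the positive part minus the negative part. [folklore] -/
theorem qval_eq (ts : List QTerm) :
    qval x ts = ((ts.filter fun t => t.pos == true).map fun t => t.val x).sum -
      ((ts.filter fun t => t.pos == false).map fun t => t.val x).sum := by
  rw [sum_filter_val, sum_filter_val, qval, sum_map_sub]
  congr 1
  refine List.map_congr_left fun t _ => ?_
  cases t.pos <;> simp

/-- **Soundness of the quadratic check**: rows valid at `x ≥ 0` and `checkQ` passes ⇒ `0 ≤ M₀(x) · F(x)`. [folklore] -/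
theorem soundQ (hx : ∀ i, 0 ≤ x i) (M0 : List (List ℕ × ℕ)) (ts : List QTerm) (rows : List Row) (lrows : List LinRow)
    (hrows : (rows.map fun r => (r.wt : ℝ) * evalM x r.mult * (linEval x r.e1 * linEval x r.e2)).sum ≤
      (rows.map fun r => (r.wt : ℝ) * evalM x r.mult * (linEval x r.e3 * linEval x r.e4)).sum)
    (hlrows : ∀ r ∈ lrows, linEval x r.eLo ≤ linEval x r.eHi)
    (h : checkQ M0 ts rows lrows = true) : 0 ≤ m0val x M0 * qval x ts := by
  have key := soundG x hx _ _ rows lrows hrows hlrows h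
  rw [evalT_qTerms, evalT_qTerms] at key
  rw [qval_eq, mul_sub]
  linarith

/-- **Soundness of the bucketed quadratic check.** [folklore] -/
theorem soundQ_of_buckets (hx : ∀ i, 0 ≤ x i) (M0 : List (List ℕ × ℕ)) (ts : List QTerm) (rows : List Row)
    (lrows : List LinRow) {nb : ℕ} (hnb : 0 < nb)
    (hrows : (rows.map fun r => (r.wt : ℝ) * evalM x r.mult * (linEval x r.e1 * linEval x r.e2)).sum ≤
      (rows.map fun r => (r.wt : ℝ) * evalM x r.mult * (linEval x r.e3 * linEval x r.e4)).sum)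
    (hlrows : ∀ r ∈ lrows, linEval x r.eLo ≤ linEval x r.eHi)
    (h : ∀ b < nb, checkQB nb b M0 ts rows lrows = true) : 0 ≤ m0val x M0 * qval x ts := by
  have key := soundG_of_buckets x hx _ _ rows lrows hnb hrows hlrows h
  rw [evalT_qTerms, evalT_qTerms] at key
  rw [qval_eq, mul_sub]
  linarith

/-- **The target from the multiplier's positivity**: `0 ≤ M₀·F` and `0 < M₀` give `0 ≤ F`. [folklore] -/
theorem qval_nonneg_of_pos (M0 : List (List ℕ × ℕ)) (ts : List QTerm) (hMF : 0 ≤ m0val x M0 * qval x ts)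
    (hM : 0 < m0val x M0) : 0 ≤ qval x ts := by
  by_contra hq
  push Not at hq
  have : m0val x M0 * qval x ts < 0 := mul_neg_of_pos_of_neg hM hq
  linarith

/-- `M₀` is nonnegative at nonnegative points. [folklore] -/
theorem m0val_nonneg (hx : ∀ i, 0 ≤ x i) (M0 : List (List ℕ × ℕ)) : 0 ≤ m0val x M0 :=
  List.sum_nonneg fun y hy => by
    obtain ⟨p, _, rfl⟩ := List.mem_map.1 hy
    exact mul_nonneg (Nat.cast_nonneg _) (evalM_nonneg x hx _)

/-- **Positivity of `M₀`**: if `x ≥ 0`, some monomial of `M₀` has positive weight and all ITS cells are positive at `x`,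
then `M₀(x) > 0`. [folklore] -/
theorem m0val_pos (hx : ∀ i, 0 ≤ x i) (M0 : List (List ℕ × ℕ)) {p : List ℕ × ℕ} (hp : p ∈ M0) (hw : 0 < p.2)
    (hcells : ∀ c ∈ p.1, 0 < x c) : 0 < m0val x M0 := by
  have hterm : 0 < (p.2 : ℝ) * evalM x p.1 := by
    refine mul_pos (by exact_mod_cast hw) ?_
    unfold evalM
    exact List.prod_pos fun y hy => by
      obtain ⟨c, hc, rfl⟩ := List.mem_map.1 hy
      exact hcells c hc
  have hmem : (p.2 : ℝ) * evalM x p.1 ∈ M0.map fun q => (q.2 : ℝ) * evalM x q.1 := List.mem_map.2 ⟨p, hp, rfl⟩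
  exact lt_of_lt_of_le hterm (List.single_le_sum (fun y hy => by
    obtain ⟨q, _, rfl⟩ := List.mem_map.1 hy
    exact mul_nonneg (Nat.cast_nonneg _) (evalM_nonneg x hx _)) _ hmem)

/-- Tiny self-test: `x₀·x₁ − x₀·x₀ ≥ 0` given the linear row `x₀ ≤ x₁`, multiplier `M₀ = 1`. [folklore] -/
example : checkQ [([], 1)] [⟨[0], [1], 1, true⟩, ⟨[0], [0], 1, false⟩] [] [⟨[0], [1], [0], 1⟩] = true := by decide

end CertCheck

end Summit.CriticalPhenomena.PercolationContinuityZ3.Theorems
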